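import Summits.BirchSwinnertonDyer.BirchSwinnertonDyer.Theorems.ByReductionTypeAtTwoRankOneAtTwoBigImageOddLocalOneDoorHalvesJoint
import Summits.BirchSwinnertonDyer.BirchSwinnertonDyer.Theorems.ByReductionTypeAtTwoRankOneAtTwoBigImageOddLocalOneDoorHalvesJointDoor
import HarnessLib

/-!
# Route ByReductionTypeAtTwo, crux `RankOneAtTwoBigImageOddLocal` (stmt-BirchSwinnertonDyer-23715), LINE v8.6 `one_door_analytic`:
# U ⟺ Kolyvagin's upper bound at `2` over `K` on the doors, L ⟺ the reverse inequality — modulo PRINT ALONE (no rank-`0` input)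

Width prover seat `bsd-line-fkl-p2` g9 (2026-08-28), `--supports stmt-BirchSwinnertonDyer-23715`.  THEOREMS ONLY; nothing is asserted;
BSD is not proved by any of this.  Sequel of `…OneDoorHalvesJoint.lean` (§1: the `2`-adic defects of `W`, `Wd`, `W ⊗ K` ADD; over-`K`
halves ⟺ joint halves of the pair) and `…OneDoorHalvesJointDoor.lean` (§2–§4: per door datum, U's inequality IS the joint upper half;
the c-corrected K-binder IS the upper half over `K`; doors are Kolyvagin-admissible and carry conductor-`1` data).

What is new relative to g8's `…OneDoorHalvesKNamed.lean` (p629657: U ⟺ hXU′ and L ⟺ hXL′ «modulo PRINT + `S_rankZeroTwin`»): the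
hypothesis `S_rankZeroTwin` — rank-`0` `BSD₂` of every non-CM curve, i.e. the route's OWN four rank-`0` cruxes 19095–19098 — is DROPPED.

* §5 `doorIndexLawUpperCAtTwo_of_shaUpperCAtTwo_onDoors` / `…_print`: AN-28c-U (`stub_doorUpperC`'s statement) from Kolyvagin's
  c-corrected UPPER bound at `2` over `K` (on door-admissible fields, resp. g8's `hXU` verbatim), modulo Gross–Zagier, Kolyvagin, GZK,
  modularity, Milne 1972 ONLY; dually `doorIndexLawLowerCAtTwo_of_shaLowerCAtTwo_onDoors` / `…_print`.
* §6 `doorIndexLawUpperCAtTwo_iff_shaUpperCAtTwo_onDoors`, `doorIndexLawLowerCAtTwo_iff_shaLowerCAtTwo_onDoors`: the iffs, PRINT only.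

Reading for the planner-of-record / the pen (split text `Lines/one_door_analytic_split.md`): **the rank-`0` cruxes are NOT in the cone of
either half-child** U, L of 23715; U ≡ «Kolyvagin's upper bound EXACT at 2 over K on the doors» and L ≡ «the reverse inequality», each
modulo the five printed facts alone.  Rank-`0` `BSD₂` of the twin is spent exactly once, in the ASSEMBLY `BSD₂(W) ⟸ U ∧ L ∧ BSD₂(Wd)`, and
there U pairs with the twin's LOWER half only and L with its UPPER half only (`…OneDoorHalvesJointCrossed.lean`).

References: [GrossZagier1986] Thm. I.6.3, V.§2; [GrossLMS1991] Thm. 1.3, §2 Conj. (2.2), §4; [KolyvaginEulerSystems1990] Thm. A;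
[Milne1972ArithmeticAV] §1 Thm. 1; [McCallumLMS1991] §5; [Miller2011LMS] Def. 1.1.
-/

set_option autoImplicit false
-- the Theorems namespace of this sub repeats the summit name by design (D-0017 nested layout)
set_option linter.dupNamespace false

noncomputable section

open scoped Classical

namespace Summit.BirchSwinnertonDyer.BirchSwinnertonDyer.Theorems.RankOneAtTwoOneDoor

open WeierstrassCurve NumberField Literature.NumberTheory.EllipticCurves Literature.NumberTheory.EllipticCurves.ModularForms
  Literature.NumberTheory.EllipticCurves.Rank1Residual
  Literature.NumberTheory.EllipticCurves.Rank1Residual.Typed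
  Literature.NumberTheory.EllipticCurves.KrizLi2019
  Summit.BirchSwinnertonDyer.Rank1Residual
  Summit.BirchSwinnertonDyer.Rank1Residual.AdditivePotMult
  Summit.BirchSwinnertonDyer.Rank1Residual.F1Sign2
  Summit.BirchSwinnertonDyer.Rank1Residual.F1Sign2.TranspositionDoor
  Summit.BirchSwinnertonDyer.BirchSwinnertonDyer.Theses.ByReductionTypeAtTwo
  Summit.BirchSwinnertonDyer.BirchSwinnertonDyer.Theorems.CMExactDescent
  Summit.BirchSwinnertonDyer.BirchSwinnertonDyer.Theorems.SchneiderFree.Upper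

/-! ### §5 The named halves from the one-sided K-binders ON THE DOORS — PRINT ONLY, no `S_rankZeroTwin` -/

/-- **AN-28c-U `DoorIndexLawUpperCAtTwo` FROM KOLYVAGIN'S UPPER BOUND AT `2` OVER `K` ON THE DOORS, modulo PRINT ALONE.**  Binders:
Gross–Zagier (`hGZ`), Kolyvagin (`hKo`), GZK (`hGZK`), modularity as a newform (`hnf`), Milne 1972 any-model (`hMilneC`), and `hXU` = g8's
c-corrected conductor-`1` binder restricted to DOOR-ADMISSIBLE Heegner fields (with U's odd-torsion binder): for `W` non-CM globally
minimal with `ρ_{W,2^n}` onto, odd torsion, odd `∏ c_ℓ`, `r_an = 1`, every `K` with `d_K` door-admissible, every datum `Dt`, `β`, `ι` and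
conductor-`1` Kolyvagin–Heegner datum with `y_K` of infinite order and exact exponent `M₀`: `ord₂ #Ш(E_K)[2^∞] + 2·v₂(c) ≤ 2·M₀`.  THEN U.
Route: at a door datum of U, the door carries a conductor-`1` datum (§4), `hXU` there is the upper half over `K` (§3), which is the joint upper
half of the pair (§1, `(★)`, Milne), which is U's inequality (§2, pair ledger).  NO rank-`0` `BSD₂` input (compare p629657
`doorIndexLawUpperCAtTwo_of_shaUpperCAtTwo`: «+ `S_rankZeroTwin`»).  Conditional on `hXU` by design; BSD is not proved by this.
[cite: GrossLMS1991, Thm. 1.3 and §4] [cite: KolyvaginEulerSystems1990, Thm. A] [cite: Milne1972ArithmeticAV, §1 Thm. 1] -/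
theorem doorIndexLawUpperCAtTwo_of_shaUpperCAtTwo_onDoors
    (hGZ : ∀ (N : ℕ) [NeZero N] (W : WeierstrassCurve ℚ) (K : Type) [Field K] [NumberField K], gross_zagier N W K)
    (hKo : ∀ (N : ℕ) [NeZero N] (W : WeierstrassCurve ℚ) (K : Type) [Field K] [NumberField K], kolyvagin N W K)
    (hGZK : rank_eq_analyticRank_of_analyticRank_le_one) (hnf : exists_isNewformOf)
    (hMilneC : Milne1972.bsdQuotient_baseChange_quadratic_anyModel)
    (hXU : ∀ (W : WeierstrassCurve ℚ) [W.IsElliptic] [W.IsGloballyMinimal] [NeZero (W.conductorNorm ℤ)],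
        ¬ W.HasCM → (∀ n : ℕ, W.HasSurjectiveModNGaloisRep ((2 ^ n : ℕ) : ℤ)) → Odd W.torsionOrder → Odd W.tamagawaProduct →
        W.analyticRank = 1 →
        ∀ (K : Type) [Field K] [NumberField K], IsImaginaryQuadratic K → DoorAdmissible W (NumberField.discr K) →
          ∀ (Dt : ModularParametrizationData W (W.conductorNorm ℤ)) (β : ℤ) (ι : K →+* ℂ) (d₁ : KolyvaginHeegnerData Dt β ι 1),
            ¬ IsOfFinAddOrder d₁.derivedPoint → ∀ (M₀ : ℕ),
            (∃ Q : (W.baseChange (ringClassField K ι 1)).toAffine.Point, ((2 ^ M₀ : ℕ) : ℤ) • Q = d₁.derivedPoint) →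
            (¬ ∃ Q : (W.baseChange (ringClassField K ι 1)).toAffine.Point, ((2 ^ (M₀ + 1) : ℕ) : ℤ) • Q = d₁.derivedPoint) →
            (padicValNat 2 (Nat.card (AddCommGroup.primaryComponent (W.baseChange K).sha 2)) : ℤ) + 2 * padicValInt 2 Dt.c ≤ 2 * M₀) :
    DoorIndexLawUpperCAtTwo := by
  intro W _ _ _ hCM hsurj hT hc hr K _ _ hK hadm hLt Dt H ι P hP Wd _ _ Cd hWd m hm
  have hmod : hasEntireLFunction_rat := hasEntireLFunction_rat_of_exists_isNewformOf hnf
  have h2 : Module.finrank ℚ K = 2 := hK.1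
  obtain ⟨hodd, h3, -, -⟩ := kolyvaginAdmissible_of_doorAdmissible W hadm
  have hH : SatisfiesHeegnerHypothesis (W.conductorNorm ℤ) K := satisfiesHeegnerHypothesis_of_doorAdmissible W K hK hadm
  obtain ⟨β, d₁, M₀, hy, hdiv, hndiv⟩ := exists_kolyvaginDatum_at_door hmod W hr K hK (hGZ _ W K) hH hLt Dt ι
  have hshaU := hXU W hCM hsurj hT hc hr K hK hadm Dt β ι d₁ hy M₀ hdiv hndiv
  have hρ2 : W.HasSurjectiveModNGaloisRep 2 := by
    have h := hsurj 1
    norm_num at h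
    exact h
  obtain ⟨hrd, hrK⟩ := analyticRank_twin_and_baseChange_of_rankOne W K Dt β ι d₁ Wd (hGZ _ W K) hmod hK hH hr hy ⟨Cd, hWd⟩
  have hKU : MissingUpperBoundOverCAt (W.baseChange K) 2 :=
    (upperOverC_baseChange_two_iff_shaUpperC_at W K Dt β ι d₁ (hGZ _ W K) hGZK hmod hρ2 hc hK hodd h3 hH hrK hdiv hndiv).mpr hshaU
  haveI hEK : (W.baseChange K).IsElliptic := isElliptic_baseChange' W K
  obtain ⟨-, hfinW⟩ := hGZK W hr.le
  obtain ⟨-, hfinD⟩ := hGZK Wd (by rw [hrd]; exact zero_le_one)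
  have hV : ∃ C : VariableChange K, C • W.baseChange K = W.baseChange K := ⟨1, one_smul _ _⟩
  obtain ⟨hshaK, hWR⟩ := hMilneC W K h2 Wd ⟨Cd, hWd⟩ (W.baseChange K) hV hfinW hfinD
  obtain ⟨-, -, -, -, q, q', hq, hq', -⟩ :=
    doorPairLedger_package_at W hT hc hr K hK (hGZ _ W K) (hKo _ W K) hadm hLt Dt H ι P hP Wd Cd hWd hnf hGZK
  have hJ : JointUpperBoundAt W Wd 2 :=
    jointUpperBoundAt_of_upperOverC W 2 K Wd (W.baseChange K) hmod h2 ⟨Cd, hWd⟩ hV hfinW hfinD hshaK hWR hKU ⟨q', hq'⟩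
  exact (jointUpperBoundAt_two_iff_doorLawGeC_at W hT hc hr K hK (hGZ _ W K) (hKo _ W K) hadm hLt Dt H ι P hP Wd Cd hWd hnf hGZK).mp
    hJ m hm

/-- **AN-28c-L `DoorIndexLawLowerCAtTwo` FROM THE REVERSE K-INEQUALITY ON THE DOORS, modulo PRINT ALONE** (`hXL`: `2·M₀ ≤
ord₂ #Ш(E_K)[2^∞] + 2·v₂(c)` on door-admissible fields; no `S_rankZeroTwin`, compare p629657 `doorIndexLawLowerCAtTwo_of_shaLowerCAtTwo`).
Conditional by design. [cite: GrossLMS1991, §2 Conj. (2.2) and §4] [cite: Milne1972ArithmeticAV, §1 Thm. 1] -/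
theorem doorIndexLawLowerCAtTwo_of_shaLowerCAtTwo_onDoors
    (hGZ : ∀ (N : ℕ) [NeZero N] (W : WeierstrassCurve ℚ) (K : Type) [Field K] [NumberField K], gross_zagier N W K)
    (hKo : ∀ (N : ℕ) [NeZero N] (W : WeierstrassCurve ℚ) (K : Type) [Field K] [NumberField K], kolyvagin N W K)
    (hGZK : rank_eq_analyticRank_of_analyticRank_le_one) (hnf : exists_isNewformOf)
    (hMilneC : Milne1972.bsdQuotient_baseChange_quadratic_anyModel)
    (hXL : ∀ (W : WeierstrassCurve ℚ) [W.IsElliptic] [W.IsGloballyMinimal] [NeZero (W.conductorNorm ℤ)],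
        ¬ W.HasCM → (∀ n : ℕ, W.HasSurjectiveModNGaloisRep ((2 ^ n : ℕ) : ℤ)) → Odd W.torsionOrder → Odd W.tamagawaProduct →
        W.analyticRank = 1 →
        ∀ (K : Type) [Field K] [NumberField K], IsImaginaryQuadratic K → DoorAdmissible W (NumberField.discr K) →
          ∀ (Dt : ModularParametrizationData W (W.conductorNorm ℤ)) (β : ℤ) (ι : K →+* ℂ) (d₁ : KolyvaginHeegnerData Dt β ι 1),
            ¬ IsOfFinAddOrder d₁.derivedPoint → ∀ (M₀ : ℕ),
            (∃ Q : (W.baseChange (ringClassField K ι 1)).toAffine.Point, ((2 ^ M₀ : ℕ) : ℤ) • Q = d₁.derivedPoint) →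
            (¬ ∃ Q : (W.baseChange (ringClassField K ι 1)).toAffine.Point, ((2 ^ (M₀ + 1) : ℕ) : ℤ) • Q = d₁.derivedPoint) →
            2 * (M₀ : ℤ) ≤ (padicValNat 2 (Nat.card (AddCommGroup.primaryComponent (W.baseChange K).sha 2)) : ℤ) + 2 * padicValInt 2 Dt.c) :
    DoorIndexLawLowerCAtTwo := by
  intro W _ _ _ hCM hsurj hT hc hr K _ _ hK hadm hLt Dt H ι P hP Wd _ _ Cd hWd m hm
  have hmod : hasEntireLFunction_rat := hasEntireLFunction_rat_of_exists_isNewformOf hnf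
  have h2 : Module.finrank ℚ K = 2 := hK.1
  obtain ⟨hodd, h3, -, -⟩ := kolyvaginAdmissible_of_doorAdmissible W hadm
  have hH : SatisfiesHeegnerHypothesis (W.conductorNorm ℤ) K := satisfiesHeegnerHypothesis_of_doorAdmissible W K hK hadm
  obtain ⟨β, d₁, M₀, hy, hdiv, hndiv⟩ := exists_kolyvaginDatum_at_door hmod W hr K hK (hGZ _ W K) hH hLt Dt ι
  have hshaL := hXL W hCM hsurj hT hc hr K hK hadm Dt β ι d₁ hy M₀ hdiv hndiv
  have hρ2 : W.HasSurjectiveModNGaloisRep 2 := by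
    have h := hsurj 1
    norm_num at h
    exact h
  obtain ⟨hrd, hrK⟩ := analyticRank_twin_and_baseChange_of_rankOne W K Dt β ι d₁ Wd (hGZ _ W K) hmod hK hH hr hy ⟨Cd, hWd⟩
  have hKL : MissingLowerBoundOverCAt (W.baseChange K) 2 :=
    (lowerOverC_baseChange_two_iff_shaLowerC_at W K Dt β ι d₁ (hGZ _ W K) hGZK hmod hρ2 hc hK hodd h3 hH hrK hdiv hndiv).mpr hshaL
  haveI hEK : (W.baseChange K).IsElliptic := isElliptic_baseChange' W K
  obtain ⟨-, hfinW⟩ := hGZK W hr.le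
  obtain ⟨-, hfinD⟩ := hGZK Wd (by rw [hrd]; exact zero_le_one)
  have hV : ∃ C : VariableChange K, C • W.baseChange K = W.baseChange K := ⟨1, one_smul _ _⟩
  obtain ⟨hshaK, hWR⟩ := hMilneC W K h2 Wd ⟨Cd, hWd⟩ (W.baseChange K) hV hfinW hfinD
  obtain ⟨-, -, -, -, q, q', hq, hq', -⟩ :=
    doorPairLedger_package_at W hT hc hr K hK (hGZ _ W K) (hKo _ W K) hadm hLt Dt H ι P hP Wd Cd hWd hnf hGZK
  have hJ : JointLowerBoundAt W Wd 2 :=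
    jointLowerBoundAt_of_lowerOverC W 2 K Wd (W.baseChange K) hmod h2 ⟨Cd, hWd⟩ hV hfinW hfinD hshaK hWR hKL ⟨q', hq'⟩
  exact (jointLowerBoundAt_two_iff_doorLawLeC_at W hT hc hr K hK (hGZ _ W K) (hKo _ W K) hadm hLt Dt H ι P hP Wd Cd hWd hnf hGZK).mp
    hJ m hm

/-- **U from g8's `hXU` VERBATIM (all Kolyvagin-admissible fields, no odd-torsion binder), modulo PRINT ALONE** — the statement of
`doorIndexLawUpperCAtTwo_of_shaUpperCAtTwo` (p629657) with `S_rankZeroTwin` DROPPED: a door-admissible `d_K` is Kolyvagin-admissible (§4).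
Conditional by design. [cite: GrossLMS1991, Thm. 1.3 and §4] [cite: KolyvaginEulerSystems1990, Thm. A] -/
theorem doorIndexLawUpperCAtTwo_of_shaUpperCAtTwo_print
    (hGZ : ∀ (N : ℕ) [NeZero N] (W : WeierstrassCurve ℚ) (K : Type) [Field K] [NumberField K], gross_zagier N W K)
    (hKo : ∀ (N : ℕ) [NeZero N] (W : WeierstrassCurve ℚ) (K : Type) [Field K] [NumberField K], kolyvagin N W K)
    (hGZK : rank_eq_analyticRank_of_analyticRank_le_one) (hnf : exists_isNewformOf)
    (hMilneC : Milne1972.bsdQuotient_baseChange_quadratic_anyModel)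
    (hXU : ∀ (W : WeierstrassCurve ℚ) [W.IsElliptic] [W.IsGloballyMinimal] [NeZero (W.conductorNorm ℤ)],
      ¬ W.HasCM → (∀ n : ℕ, W.HasSurjectiveModNGaloisRep ((2 ^ n : ℕ) : ℤ)) → Odd W.tamagawaProduct → W.analyticRank = 1 →
      ∀ (K : Type) [Field K] [NumberField K], IsImaginaryQuadratic K → Odd (NumberField.discr K) →
        NumberField.discr K ≠ -3 → SatisfiesHeegnerHypothesis (W.conductorNorm ℤ) K →
        ¬ IsSquare ((NumberField.discr K : ℚ) * -|W.Δ|) → ¬ IsSquare ((NumberField.discr K : ℚ) * (-(2 * |W.Δ|))) →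
        ∀ (Dt : ModularParametrizationData W (W.conductorNorm ℤ)) (β : ℤ) (ι : K →+* ℂ) (d₁ : KolyvaginHeegnerData Dt β ι 1),
          ¬ IsOfFinAddOrder d₁.derivedPoint → ∀ (M₀ : ℕ),
          (∃ Q : (W.baseChange (ringClassField K ι 1)).toAffine.Point, ((2 ^ M₀ : ℕ) : ℤ) • Q = d₁.derivedPoint) →
          (¬ ∃ Q : (W.baseChange (ringClassField K ι 1)).toAffine.Point, ((2 ^ (M₀ + 1) : ℕ) : ℤ) • Q = d₁.derivedPoint) →
          (padicValNat 2 (Nat.card (AddCommGroup.primaryComponent (W.baseChange K).sha 2)) : ℤ) + 2 * padicValInt 2 Dt.c ≤ 2 * M₀) :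
    DoorIndexLawUpperCAtTwo := by
  refine doorIndexLawUpperCAtTwo_of_shaUpperCAtTwo_onDoors hGZ hKo hGZK hnf hMilneC ?_
  intro W _ _ _ hCM hsurj _hT hc hr K _ _ hK hadm Dt β ι d₁ hy M₀ hdiv hndiv
  obtain ⟨hodd, h3, hsq1, hsq2⟩ := kolyvaginAdmissible_of_doorAdmissible W hadm
  exact hXU W hCM hsurj hc hr K hK hodd h3 (satisfiesHeegnerHypothesis_of_doorAdmissible W K hK hadm) hsq1 hsq2 Dt β ι d₁ hy M₀
    hdiv hndiv

/-- **L from g8's `hXL` VERBATIM, modulo PRINT ALONE** (`S_rankZeroTwin` dropped from `doorIndexLawLowerCAtTwo_of_shaLowerCAtTwo`).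
Conditional by design. [cite: GrossLMS1991, §2 Conj. (2.2) and §4] -/
theorem doorIndexLawLowerCAtTwo_of_shaLowerCAtTwo_print
    (hGZ : ∀ (N : ℕ) [NeZero N] (W : WeierstrassCurve ℚ) (K : Type) [Field K] [NumberField K], gross_zagier N W K)
    (hKo : ∀ (N : ℕ) [NeZero N] (W : WeierstrassCurve ℚ) (K : Type) [Field K] [NumberField K], kolyvagin N W K)
    (hGZK : rank_eq_analyticRank_of_analyticRank_le_one) (hnf : exists_isNewformOf)
    (hMilneC : Milne1972.bsdQuotient_baseChange_quadratic_anyModel)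
    (hXL : ∀ (W : WeierstrassCurve ℚ) [W.IsElliptic] [W.IsGloballyMinimal] [NeZero (W.conductorNorm ℤ)],
      ¬ W.HasCM → (∀ n : ℕ, W.HasSurjectiveModNGaloisRep ((2 ^ n : ℕ) : ℤ)) → Odd W.tamagawaProduct → W.analyticRank = 1 →
      ∀ (K : Type) [Field K] [NumberField K], IsImaginaryQuadratic K → Odd (NumberField.discr K) →
        NumberField.discr K ≠ -3 → SatisfiesHeegnerHypothesis (W.conductorNorm ℤ) K →
        ¬ IsSquare ((NumberField.discr K : ℚ) * -|W.Δ|) → ¬ IsSquare ((NumberField.discr K : ℚ) * (-(2 * |W.Δ|))) →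
        ∀ (Dt : ModularParametrizationData W (W.conductorNorm ℤ)) (β : ℤ) (ι : K →+* ℂ) (d₁ : KolyvaginHeegnerData Dt β ι 1),
          ¬ IsOfFinAddOrder d₁.derivedPoint → ∀ (M₀ : ℕ),
          (∃ Q : (W.baseChange (ringClassField K ι 1)).toAffine.Point, ((2 ^ M₀ : ℕ) : ℤ) • Q = d₁.derivedPoint) →
          (¬ ∃ Q : (W.baseChange (ringClassField K ι 1)).toAffine.Point, ((2 ^ (M₀ + 1) : ℕ) : ℤ) • Q = d₁.derivedPoint) →
          2 * (M₀ : ℤ) ≤ (padicValNat 2 (Nat.card (AddCommGroup.primaryComponent (W.baseChange K).sha 2)) : ℤ) + 2 * padicValInt 2 Dt.c) :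
    DoorIndexLawLowerCAtTwo := by
  refine doorIndexLawLowerCAtTwo_of_shaLowerCAtTwo_onDoors hGZ hKo hGZK hnf hMilneC ?_
  intro W _ _ _ hCM hsurj _hT hc hr K _ _ hK hadm Dt β ι d₁ hy M₀ hdiv hndiv
  obtain ⟨hodd, h3, hsq1, hsq2⟩ := kolyvaginAdmissible_of_doorAdmissible W hadm
  exact hXL W hCM hsurj hc hr K hK hodd h3 (satisfiesHeegnerHypothesis_of_doorAdmissible W K hK hadm) hsq1 hsq2 Dt β ι d₁ hy M₀
    hdiv hndiv

/-! ### §6 The iffs on the doors — PRINT ONLY: the rank-`0` cruxes are not in the cone of either half-child -/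

/-- **AN-28c-U ⟺ KOLYVAGIN'S UPPER BOUND AT `2` OVER `K` ON THE DOORS, modulo PRINT ALONE** (Gross–Zagier, Kolyvagin, GZK, modularity,
Milne 1972).  Right-hand side = g8's `hXU` on the door-admissible Heegner fields (`d_K < 0` square-free, `≡ 1 (mod 8)`, every `q ∣ d_K`
good, `(d_K/ℓ) = 1` at the odd bad `ℓ`), with U's odd-torsion binder.  No `S_rankZeroTwin` (compare p629657
`doorIndexLawUpperCAtTwo_iff_shaUpperCAtTwo`): **the route's rank-`0` cruxes are NOT in the cone of the child U** — they are needed once, in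
the assembly, and there U pairs with the twin's LOWER half only (`…OneDoorHalvesJoint.lean`).  Conditional by design.
[cite: GrossLMS1991, Thm. 1.3, §2 Conj. (2.2) and §4] [cite: Milne1972ArithmeticAV, §1 Thm. 1] -/
theorem doorIndexLawUpperCAtTwo_iff_shaUpperCAtTwo_onDoors
    (hGZ : ∀ (N : ℕ) [NeZero N] (W : WeierstrassCurve ℚ) (K : Type) [Field K] [NumberField K], gross_zagier N W K)
    (hKo : ∀ (N : ℕ) [NeZero N] (W : WeierstrassCurve ℚ) (K : Type) [Field K] [NumberField K], kolyvagin N W K)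
    (hGZK : rank_eq_analyticRank_of_analyticRank_le_one) (hnf : exists_isNewformOf)
    (hMilneC : Milne1972.bsdQuotient_baseChange_quadratic_anyModel) :
    DoorIndexLawUpperCAtTwo ↔
      ∀ (W : WeierstrassCurve ℚ) [W.IsElliptic] [W.IsGloballyMinimal] [NeZero (W.conductorNorm ℤ)],
        ¬ W.HasCM → (∀ n : ℕ, W.HasSurjectiveModNGaloisRep ((2 ^ n : ℕ) : ℤ)) → Odd W.torsionOrder → Odd W.tamagawaProduct →
        W.analyticRank = 1 →
        ∀ (K : Type) [Field K] [NumberField K], IsImaginaryQuadratic K → DoorAdmissible W (NumberField.discr K) →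
          ∀ (Dt : ModularParametrizationData W (W.conductorNorm ℤ)) (β : ℤ) (ι : K →+* ℂ) (d₁ : KolyvaginHeegnerData Dt β ι 1),
            ¬ IsOfFinAddOrder d₁.derivedPoint → ∀ (M₀ : ℕ),
            (∃ Q : (W.baseChange (ringClassField K ι 1)).toAffine.Point, ((2 ^ M₀ : ℕ) : ℤ) • Q = d₁.derivedPoint) →
            (¬ ∃ Q : (W.baseChange (ringClassField K ι 1)).toAffine.Point, ((2 ^ (M₀ + 1) : ℕ) : ℤ) • Q = d₁.derivedPoint) →
            (padicValNat 2 (Nat.card (AddCommGroup.primaryComponent (W.baseChange K).sha 2)) : ℤ) + 2 * padicValInt 2 Dt.c ≤ 2 * M₀ := by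
  have hmod : hasEntireLFunction_rat := hasEntireLFunction_rat_of_exists_isNewformOf hnf
  constructor
  · intro hU W _ _ _ hCM hsurj hT hc hr K _ _ hK hadm Dt β ι d₁ hy M₀ hdiv hndiv
    have h2 : Module.finrank ℚ K = 2 := hK.1
    obtain ⟨hodd, h3, -, -⟩ := kolyvaginAdmissible_of_doorAdmissible W hadm
    have hH : SatisfiesHeegnerHypothesis (W.conductorNorm ℤ) K := satisfiesHeegnerHypothesis_of_doorAdmissible W K hK hadm
    have hρ2 : W.HasSurjectiveModNGaloisRep 2 := by
      have h := hsurj 1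
      norm_num at h
      exact h
    -- the E-side datum below `P(1)` and a minimal twin
    obtain ⟨P₀, Hd, hP₀, -⟩ := exists_heegnerPoint_map_eq_derivedPoint_one hK hH d₁
    have hD0 : (NumberField.discr K : ℚ) ≠ 0 := by exact_mod_cast NumberField.discr_ne_zero K
    haveI hEt : (W.quadraticTwist (NumberField.discr K : ℚ)).IsElliptic := W.isElliptic_quadraticTwist hD0
    obtain ⟨Cd, hCd⟩ := hasGlobalMinimalModel_rat_holds (W.quadraticTwist (NumberField.discr K : ℚ))
    haveI : (Cd • W.quadraticTwist (NumberField.discr K : ℚ)).IsGloballyMinimal := hCd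
    obtain ⟨hrd, hrK⟩ := analyticRank_twin_and_baseChange_of_rankOne W K Dt β ι d₁ (Cd • W.quadraticTwist (NumberField.discr K : ℚ))
      (hGZ _ W K) hmod hK hH hr hy ⟨Cd, rfl⟩
    have hLt : (W.quadraticTwist (NumberField.discr K : ℚ)).entireLFunction 1 ≠ 0 := by
      have h := ((Cd • W.quadraticTwist (NumberField.discr K : ℚ)).analyticRank_eq_zero_iff_holds (hmod _)).1 hrd
      rwa [entireLFunction_smul] at h
    -- the named half at this datum is the joint half, hence the half over `K`, hence the K-binder there
    have hJ : JointUpperBoundAt W (Cd • W.quadraticTwist (NumberField.discr K : ℚ)) 2 :=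
      (jointUpperBoundAt_two_iff_doorLawGeC_at W hT hc hr K hK (hGZ _ W K) (hKo _ W K) hadm hLt Dt Hd ι P₀ hP₀ _ Cd rfl hnf hGZK).mpr
        (hU W hCM hsurj hT hc hr K hK hadm hLt Dt Hd ι P₀ hP₀ _ Cd rfl)
    haveI hEK : (W.baseChange K).IsElliptic := isElliptic_baseChange' W K
    obtain ⟨-, hfinW⟩ := hGZK W hr.le
    obtain ⟨-, hfinD⟩ := hGZK (Cd • W.quadraticTwist (NumberField.discr K : ℚ)) (by rw [hrd]; exact zero_le_one)
    have hV : ∃ C : VariableChange K, C • W.baseChange K = W.baseChange K := ⟨1, one_smul _ _⟩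
    obtain ⟨hshaK, hWR⟩ := hMilneC W K h2 (Cd • W.quadraticTwist (NumberField.discr K : ℚ)) ⟨Cd, rfl⟩ (W.baseChange K) hV hfinW hfinD
    have hKside : MissingUpperBoundOverCAt (W.baseChange K) 2 :=
      upperOverC_of_jointUpperBoundAt W 2 K _ (W.baseChange K) hmod h2 ⟨Cd, rfl⟩ hV hfinW hfinD hshaK hWR hJ
    exact (upperOverC_baseChange_two_iff_shaUpperC_at W K Dt β ι d₁ (hGZ _ W K) hGZK hmod hρ2 hc hK hodd h3 hH hrK hdiv hndiv).mp hKside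
  · exact doorIndexLawUpperCAtTwo_of_shaUpperCAtTwo_onDoors hGZ hKo hGZK hnf hMilneC

/-- **AN-28c-L ⟺ THE REVERSE K-INEQUALITY ON THE DOORS, modulo PRINT ALONE** (no `S_rankZeroTwin`; compare p629657
`doorIndexLawLowerCAtTwo_iff_shaLowerCAtTwo`): the rank-`0` cruxes are not in the cone of the child L either; in the assembly L pairs with the
twin's UPPER (Kato) half only.  Conditional by design. [cite: GrossLMS1991, §2 Conj. (2.2) and §4] [cite: Milne1972ArithmeticAV, §1 Thm. 1] -/
theorem doorIndexLawLowerCAtTwo_iff_shaLowerCAtTwo_onDoors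
    (hGZ : ∀ (N : ℕ) [NeZero N] (W : WeierstrassCurve ℚ) (K : Type) [Field K] [NumberField K], gross_zagier N W K)
    (hKo : ∀ (N : ℕ) [NeZero N] (W : WeierstrassCurve ℚ) (K : Type) [Field K] [NumberField K], kolyvagin N W K)
    (hGZK : rank_eq_analyticRank_of_analyticRank_le_one) (hnf : exists_isNewformOf)
    (hMilneC : Milne1972.bsdQuotient_baseChange_quadratic_anyModel) :
    DoorIndexLawLowerCAtTwo ↔
      ∀ (W : WeierstrassCurve ℚ) [W.IsElliptic] [W.IsGloballyMinimal] [NeZero (W.conductorNorm ℤ)],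
        ¬ W.HasCM → (∀ n : ℕ, W.HasSurjectiveModNGaloisRep ((2 ^ n : ℕ) : ℤ)) → Odd W.torsionOrder → Odd W.tamagawaProduct →
        W.analyticRank = 1 →
        ∀ (K : Type) [Field K] [NumberField K], IsImaginaryQuadratic K → DoorAdmissible W (NumberField.discr K) →
          ∀ (Dt : ModularParametrizationData W (W.conductorNorm ℤ)) (β : ℤ) (ι : K →+* ℂ) (d₁ : KolyvaginHeegnerData Dt β ι 1),
            ¬ IsOfFinAddOrder d₁.derivedPoint → ∀ (M₀ : ℕ),
            (∃ Q : (W.baseChange (ringClassField K ι 1)).toAffine.Point, ((2 ^ M₀ : ℕ) : ℤ) • Q = d₁.derivedPoint) →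
            (¬ ∃ Q : (W.baseChange (ringClassField K ι 1)).toAffine.Point, ((2 ^ (M₀ + 1) : ℕ) : ℤ) • Q = d₁.derivedPoint) →
            2 * (M₀ : ℤ) ≤ (padicValNat 2 (Nat.card (AddCommGroup.primaryComponent (W.baseChange K).sha 2)) : ℤ) + 2 * padicValInt 2 Dt.c := by
  have hmod : hasEntireLFunction_rat := hasEntireLFunction_rat_of_exists_isNewformOf hnf
  constructor
  · intro hL W _ _ _ hCM hsurj hT hc hr K _ _ hK hadm Dt β ι d₁ hy M₀ hdiv hndiv
    have h2 : Module.finrank ℚ K = 2 := hK.1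
    obtain ⟨hodd, h3, -, -⟩ := kolyvaginAdmissible_of_doorAdmissible W hadm
    have hH : SatisfiesHeegnerHypothesis (W.conductorNorm ℤ) K := satisfiesHeegnerHypothesis_of_doorAdmissible W K hK hadm
    have hρ2 : W.HasSurjectiveModNGaloisRep 2 := by
      have h := hsurj 1
      norm_num at h
      exact h
    -- the E-side datum below `P(1)` and a minimal twin
    obtain ⟨P₀, Hd, hP₀, -⟩ := exists_heegnerPoint_map_eq_derivedPoint_one hK hH d₁
    have hD0 : (NumberField.discr K : ℚ) ≠ 0 := by exact_mod_cast NumberField.discr_ne_zero K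
    haveI hEt : (W.quadraticTwist (NumberField.discr K : ℚ)).IsElliptic := W.isElliptic_quadraticTwist hD0
    obtain ⟨Cd, hCd⟩ := hasGlobalMinimalModel_rat_holds (W.quadraticTwist (NumberField.discr K : ℚ))
    haveI : (Cd • W.quadraticTwist (NumberField.discr K : ℚ)).IsGloballyMinimal := hCd
    obtain ⟨hrd, hrK⟩ := analyticRank_twin_and_baseChange_of_rankOne W K Dt β ι d₁ (Cd • W.quadraticTwist (NumberField.discr K : ℚ))
      (hGZ _ W K) hmod hK hH hr hy ⟨Cd, rfl⟩
    have hLt : (W.quadraticTwist (NumberField.discr K : ℚ)).entireLFunction 1 ≠ 0 := by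
      have h := ((Cd • W.quadraticTwist (NumberField.discr K : ℚ)).analyticRank_eq_zero_iff_holds (hmod _)).1 hrd
      rwa [entireLFunction_smul] at h
    -- the named half at this datum is the joint half, hence the half over `K`, hence the K-binder there
    have hJ : JointLowerBoundAt W (Cd • W.quadraticTwist (NumberField.discr K : ℚ)) 2 :=
      (jointLowerBoundAt_two_iff_doorLawLeC_at W hT hc hr K hK (hGZ _ W K) (hKo _ W K) hadm hLt Dt Hd ι P₀ hP₀ _ Cd rfl hnf hGZK).mpr
        (hL W hCM hsurj hT hc hr K hK hadm hLt Dt Hd ι P₀ hP₀ _ Cd rfl)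
    haveI hEK : (W.baseChange K).IsElliptic := isElliptic_baseChange' W K
    obtain ⟨-, hfinW⟩ := hGZK W hr.le
    obtain ⟨-, hfinD⟩ := hGZK (Cd • W.quadraticTwist (NumberField.discr K : ℚ)) (by rw [hrd]; exact zero_le_one)
    have hV : ∃ C : VariableChange K, C • W.baseChange K = W.baseChange K := ⟨1, one_smul _ _⟩
    obtain ⟨hshaK, hWR⟩ := hMilneC W K h2 (Cd • W.quadraticTwist (NumberField.discr K : ℚ)) ⟨Cd, rfl⟩ (W.baseChange K) hV hfinW hfinD
    have hKside : MissingLowerBoundOverCAt (W.baseChange K) 2 :=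
      lowerOverC_of_jointLowerBoundAt W 2 K _ (W.baseChange K) hmod h2 ⟨Cd, rfl⟩ hV hfinW hfinD hshaK hWR hJ
    exact (lowerOverC_baseChange_two_iff_shaLowerC_at W K Dt β ι d₁ (hGZ _ W K) hGZK hmod hρ2 hc hK hodd h3 hH hrK hdiv hndiv).mp hKside
  · exact doorIndexLawLowerCAtTwo_of_shaLowerCAtTwo_onDoors hGZ hKo hGZK hnf hMilneC

/-! ### §11 Converse on the doors, U-side: U ⟹ 22137's REGISTERED `stub_upperBoundAtTwo` (c-free, verbatim conclusion) on door-admissible fields -/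

/-- **AN-28c-U ⟹ route GenusKolyvaginAtTwo's registered `stub_upperBoundAtTwo` of crux 22137 ON THE SLICE'S DOOR-ADMISSIBLE FIELDS, modulo
PRINT ALONE.**  For `W` on the slice, `K` with `d_K` door-admissible, ANY datum `Dt`, `β`, `ι`, conductor-`1` datum with `y_K = P(1)` of infinite
order and ANY `M₀` with `2^{M₀+1} ∤ P(1)` in `E(K[1])` (the stub's only hypothesis — an upper bound for the exact exponent):
`#Ш(E_K)[2^∞] ∣ 4^{M₀}`.  Route: the exact exponent `M₁ ≤ M₀` exists (finite generation); U gives the c-corrected bound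
`ord₂ #Ш(E_K)[2^∞] + 2·v₂(c) ≤ 2·M₁` there (§6), a fortiori the c-free one; `#Ш(E_K)[2^∞]` is a power of `2`.  With §8 of
`…OneDoorHalvesJointCrossed.lean` (the stub + `S_manin` ⟹ U): on door-admissible fields of slice curves the E-side child U and the sibling's
K-side stub are the SAME statement modulo PRINT + `S_manin`.  Conditional by design. [cite: GrossLMS1991, Thm. 1.3 and §4]
[cite: McCallumLMS1991, §5 Lemma 5.1] -/
theorem upperBoundAtTwo_uncorrected_onDoors_of_doorIndexLawUpperCAtTwo
    (hGZ : ∀ (N : ℕ) [NeZero N] (W : WeierstrassCurve ℚ) (K : Type) [Field K] [NumberField K], gross_zagier N W K)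
    (hKo : ∀ (N : ℕ) [NeZero N] (W : WeierstrassCurve ℚ) (K : Type) [Field K] [NumberField K], kolyvagin N W K)
    (hGZK : rank_eq_analyticRank_of_analyticRank_le_one) (hnf : exists_isNewformOf)
    (hMilneC : Milne1972.bsdQuotient_baseChange_quadratic_anyModel) (hU : DoorIndexLawUpperCAtTwo) :
    ∀ (W : WeierstrassCurve ℚ) [W.IsElliptic] [W.IsGloballyMinimal] [NeZero (W.conductorNorm ℤ)],
      ¬ W.HasCM → (∀ n : ℕ, W.HasSurjectiveModNGaloisRep ((2 ^ n : ℕ) : ℤ)) → Odd W.torsionOrder → Odd W.tamagawaProduct →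
      W.analyticRank = 1 →
      ∀ (K : Type) [Field K] [NumberField K], IsImaginaryQuadratic K → DoorAdmissible W (NumberField.discr K) →
        ∀ (Dt : ModularParametrizationData W (W.conductorNorm ℤ)) (β : ℤ) (ι : K →+* ℂ) (d₁ : KolyvaginHeegnerData Dt β ι 1),
          ¬ IsOfFinAddOrder d₁.derivedPoint → ∀ (M₀ : ℕ),
          (¬ ∃ Q : (W.baseChange (ringClassField K ι 1)).toAffine.Point, ((2 ^ (M₀ + 1) : ℕ) : ℤ) • Q = d₁.derivedPoint) →
          Nat.card (AddCommGroup.primaryComponent (W.baseChange K).sha 2) ∣ 2 ^ (2 * M₀) := by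
  intro W _ _ _ hCM hsurj hT hc hr K _ _ hK hadm Dt β ι d₁ hy M₀ hndiv
  haveI : Fact (Nat.Prime 2) := ⟨Nat.prime_two⟩
  have hmod : hasEntireLFunction_rat := hasEntireLFunction_rat_of_exists_isNewformOf hnf
  obtain ⟨hodd, h3, -, -⟩ := kolyvaginAdmissible_of_doorAdmissible W hadm
  have hH : SatisfiesHeegnerHypothesis (W.conductorNorm ℤ) K := satisfiesHeegnerHypothesis_of_doorAdmissible W K hK hadm
  have hρ2 : W.HasSurjectiveModNGaloisRep 2 := by
    have h := hsurj 1
    norm_num at h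
    exact h
  -- the exact exponent `M₁ ≤ M₀`
  obtain ⟨M₁, hdiv₁, hndiv₁⟩ : ∃ M₁ : ℕ,
      (∃ Q : (W.baseChange (ringClassField K ι 1)).toAffine.Point, ((2 ^ M₁ : ℕ) : ℤ) • Q = d₁.derivedPoint) ∧
      ¬ ∃ Q : (W.baseChange (ringClassField K ι 1)).toAffine.Point, ((2 ^ (M₁ + 1) : ℕ) : ℤ) • Q = d₁.derivedPoint := by
    haveI : NumberField (ringClassField K ι 1) := numberField_ringClassField hK ι one_ne_zero
    haveI : (W.baseChange (ringClassField K ι 1)).IsElliptic := by rw [baseChange]; infer_instance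
    haveI : Module.Finite ℤ (W.baseChange (ringClassField K ι 1)).toAffine.Point := by
      convert (W.baseChange (ringClassField K ι 1)).module_finite_point_holds
    exact exists_pow_smul_eq_and_not_of_not_isOfFinAddOrder Nat.prime_two hy
  have hM : M₁ ≤ M₀ := by
    by_contra hlt
    push Not at hlt
    obtain ⟨Q, hQ⟩ := hdiv₁
    apply hndiv
    refine ⟨((2 ^ (M₁ - (M₀ + 1)) : ℕ) : ℤ) • Q, ?_⟩
    rw [smul_smul, ← hQ, ← Nat.cast_mul, ← pow_add, Nat.add_sub_cancel' (by omega)]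
  -- U gives the c-corrected bound at the exact exponent
  have hKU := (doorIndexLawUpperCAtTwo_iff_shaUpperCAtTwo_onDoors hGZ hKo hGZK hnf hMilneC).mp hU W hCM hsurj hT hc hr K hK hadm Dt β ι d₁
    hy M₁ hdiv₁ hndiv₁
  -- `#Ш(E_K)[2^∞]` is a power of `2`
  obtain ⟨-, hrK⟩ := analyticRank_twin_and_baseChange_of_rankOne W K Dt β ι d₁ (W.quadraticTwist (NumberField.discr K : ℚ)) (hGZ _ W K) hmod
    hK hH hr hy ⟨1, one_smul _ _⟩
  obtain ⟨hfinK, -, -⟩ := exists_shaAnOverC_baseChange_padicValRat_eq_C W K Dt β ι d₁ (hGZ _ W K) hGZK hmod hρ2 hc hK hodd h3 hH hrK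
    hdiv₁ hndiv₁
  haveI := hfinK
  haveI : Finite (AddCommGroup.primaryComponent (W.baseChange K).sha 2) := Finite.of_injective _ Subtype.val_injective
  obtain ⟨n, hn⟩ := exists_card_addPrimaryComponent_eq_pow (A := (W.baseChange K).sha) 2
  rw [hn] at hKU ⊢
  rw [padicValNat.prime_pow] at hKU
  have hc0 : (0 : ℤ) ≤ padicValInt 2 Dt.c := by positivity
  exact pow_dvd_pow 2 (by omega)

end Summit.BirchSwinnertonDyer.BirchSwinnertonDyer.Theorems.RankOneAtTwoOneDoor

end
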